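import Summits.BirchSwinnertonDyer.BirchSwinnertonDyer.Theorems.ByReductionTypeAtTwoFineSelmerConjAAtTwoAdditivePotGoodTwoLayerDoor
import Summits.BirchSwinnertonDyer.BirchSwinnertonDyer.Theorems.ByReductionTypeAtTwoFineSelmerConjAAtTwoAdditivePotGoodExplicitMinkowski
import Literature.NumberTheory.IwasawaTheory.CyclotomicTwoTotallyRamifiedEvenIndexCertificate
import HarnessLib

/-!
# Route `ByReductionTypeAtTwo` (rung K4), crux C1″ `FineSelmerConjAAtTwoAdditivePotGood` (item stmt-BirchSwinnertonDyer-22615):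
# THE TWO-LAYER DOOR FOR THE SPLITTING TYPE `2 = 𝔭²𝔮` — Fukuda's index `0` from an EVEN-INDEX CERTIFICATE (four algebraic
# integers of the cubic field, kernel), then `μ₂ = 0` from the class-number parities of `F` and `F(√2)`
# (a `--supports 22615` file; seat `bsd-2adic-k4-w1` GEN 5; sequel of `…TwoLayerDoor` for the 19 `𝔭²𝔮` rows of the census)

HONEST FRAMING (cell `bsd-2adic`, D-0036/D-0054/D-0152): types-the-object-of; closes nothing at the `∀`-level; nothing booked; BSD
is not proved by any of this. Inputs displayed BY NAME: `hLim2` (per-curve doors only). Fukuda 1994 Thm. 1 (1) is the tree's discharged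
fact; Fukuda's index `0` is PROVED from the certificate by `Literature/NumberTheory/IwasawaTheory/CyclotomicTwoTotallyRamifiedEvenIndexCertificate.lean`
(this seat, p689647): for a cubic `F` and `u, v, m, m' ∈ 𝓞_F` with `u² − 2v² = 4m`, `m² = 2m'`, `8 ∤ N(2 − m'³)`, the element
`x = (u + v√2)/2 ∈ 𝓞_{F₁}` satisfies `x² = √2·y` with `y` outside some prime `Q ∋ 2`, so `4 ∣ e(Q|2)`, the index-`2` prime of `F`
ramifies in `F₁ = F(√2)`, and every prime above `2` is totally ramified in the cyclotomic `ℤ₂`-tower.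

WHY. Of the 30 `C1″-RES` rows of GEN 4's census, 19 have `2 = 𝔭²𝔮` in the cubic point field `F = ℚ(P)`; the parity discharge of
`…TwoLayerDoor` (odd `e(w|2)`) does not reach the prime `𝔭`. Ten of them (`227772e1 237952bv1 244416cn1 261648q1 279440c1 297264q1
413952bm1 434964b1 445508b1 467928d1`) have `h(F)` odd, `h(F(√2))` odd and `𝔭` ramified in `F(√2)` (cell TSV
`addL2x/gen5/conjA2_census_j289938_classes.tsv`, columns `cyc3/cyc6/ramK6`): this file is their door, the certificate being per field
four small vectors found by the seat's `gen/cert_search.py` and checked by the kernel (stamps: sequel files).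

* §1 FIELD DOORS (unconditional): `classNumberPExp_eq_zero_of_evenIndexCertificate_of_layerOne`,
  `classicalMuVanishes_two_of_evenIndexCertificate_of_layerOne` — cubic `F`, certificate, `2 ∤ #Cl(𝓞 F)`, `e_1 = 0` ⟹ `e_n = 0` ∀ `n`, `μ₂ = 0`.
* §2 `not_eight_dvd_norm_coords` — the norm conjunct of the certificate as a `3 × 3` companion determinant (GEN 4's `norm_coords_eq_det`).
* §3 PER-CURVE DOOR `fineSelmerDual_moduleFinite_two_of_evenIndexCertificate_pointField` (mod `hLim2`): point field `ℚ(P) = ℚ(θ)` for a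
  root `θ` of an irreducible integer cubic, certificate in `𝓞 ℚ(θ)`, two parity bits ⟹ (A)₂(W).

References: [Fukuda1994] Thm. 1 (1), p. 264; [Washington1997] §13.1; [Lim2017FineSelmer] Thm. 3.5, Lemma 3.2; [CoatesSujatha2005] (A);
[NeukirchANT1999] Ch. I §8; [Marcus1977] Ch. 2 (norms as determinants).
-/

set_option autoImplicit false
-- sibling precedent (`…TwoLayerDoor.lean`): the directory name repeats the summit name
set_option linter.dupNamespace false

noncomputable section

open scoped Classical IntermediateField NumberField

namespace Summit.BirchSwinnertonDyer.BirchSwinnertonDyer.Theorems.AddKatoTwo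

open WeierstrassCurve Field Polynomial IsDedekindDomain NumberField Matrix Literature.NumberTheory.EllipticCurves
  Literature.NumberTheory.GaloisRepresentations
  Literature.NumberTheory.IwasawaTheory
  Summit.BirchSwinnertonDyer.BirchSwinnertonDyer.Theorems.AlignedTransportAtTwoTorsionPointField
  Summit.BirchSwinnertonDyer.BirchSwinnertonDyer.Theses.ByReductionTypeAtTwo

/-! ## §1 THE FIELD DOORS (unconditional) -/

section FieldDoor

variable (F : Type) [Field F] [NumberField F]

/-- **THE TWO-LAYER FIELD DOOR, even-index form, UNCONDITIONAL.** For a CUBIC number field `F`, an even-index certificate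
`u, v, m, m' ∈ 𝓞 F` (`u² − 2v² = 4m`, `m² = 2m'`, `8 ∤ N(2 − m'³)`), a cyclotomic `ℤ₂`-extension `κ`, `2 ∤ #Cl(𝓞 F)` (`e_0 = 0`) and
`e_1(κ) = 0` (`2 ∤ h(F(√2))`): `e_n(κ) = 0` for EVERY `n`. Fukuda 1994 Thm. 1 (1) (kernel `_holds`) with `n₀ = 0` from
`totallyRamifiedFrom_zero_of_evenIndexCertificate` (kernel). [cite: Fukuda1994, Thm. 1 (1), p. 264] [cite: Washington1997, §13.1 Lemma 13.3] -/
theorem classNumberPExp_eq_zero_of_evenIndexCertificate_of_layerOne (hF : Module.finrank ℚ F = 3)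
    (u v m m' : 𝓞 F) (huv : u ^ 2 - 2 * v ^ 2 = 4 * m) (hm : m ^ 2 = 2 * m')
    (hN : ¬ (8 : ℤ) ∣ Algebra.norm ℤ (2 - m' ^ 3))
    (κ : ZpExtension F 2) (hκ : κ.IsCyclotomic) (hh : ¬ 2 ∣ Nat.card (ClassGroup (𝓞 F)))
    (h1 : classNumberPExp κ 1 = 0) (n : ℕ) : classNumberPExp κ n = 0 :=
  classNumberPExp_eq_zero_of_succ_eq_zero fukuda1994_thm1_classNumberPExp_const_of_succ_eq_holds κ
    (totallyRamifiedFrom_zero_of_evenIndexCertificate hF κ hκ u v m m' huv hm hN) le_rfl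
    (classNumberPExp_zero_eq_zero_of_odd_classNumber F hh κ) h1 (Nat.zero_le n)

/-- **`μ₂ = 0` (growth form) by the two-layer door, even-index form.** UNCONDITIONAL. [cite: Fukuda1994, Thm. 1 (1), p. 264]
[cite: Washington1997, §13.1 Lemma 13.3] -/
theorem classicalMuVanishes_two_of_evenIndexCertificate_of_layerOne (hF : Module.finrank ℚ F = 3)
    (u v m m' : 𝓞 F) (huv : u ^ 2 - 2 * v ^ 2 = 4 * m) (hm : m ^ 2 = 2 * m')
    (hN : ¬ (8 : ℤ) ∣ Algebra.norm ℤ (2 - m' ^ 3))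
    (κ : ZpExtension F 2) (hκ : κ.IsCyclotomic) (hh : ¬ 2 ∣ Nat.card (ClassGroup (𝓞 F)))
    (h1 : classNumberPExp κ 1 = 0) : ClassicalMuVanishes κ :=
  classicalMuVanishes_of_eventually_const κ (c := 0) (n₀ := 0)
    fun n _ => classNumberPExp_eq_zero_of_evenIndexCertificate_of_layerOne F hF u v m m' huv hm hN κ hκ hh h1 n

end FieldDoor

/-! ## §2 The norm conjunct as a companion determinant -/

section NormConjunct

variable (K : Type) [Field K] [NumberField K]

/-- **`8 ∤ N(x + yθ + zθ²)`** from the numeric companion determinant (`norm_coords_eq_det`): the certificate's norm conjunct, decided by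
`norm_num` per row. [cite: Marcus1977, Ch. 2 (norm of an element as the determinant of multiplication)] -/
theorem not_eight_dvd_norm_coords (h3 : Module.finrank ℚ K = 3) (b : 𝓞 K) {p q r : ℤ}
    (hirr : Irreducible (Cubic.toPoly ⟨1, (p : ℚ), q, r⟩)) (hb : b ^ 3 + p * b ^ 2 + q * b + r = 0) (x y z : ℤ) {N : ℤ}
    (hdet : ((x : ℚ) • (1 : Matrix (Fin 3) (Fin 3) ℚ) + (y : ℚ) • !![(0 : ℚ), 0, -r; 1, 0, -q; 0, 1, -p] +
        (z : ℚ) • !![(0 : ℚ), 0, -r; 1, 0, -q; 0, 1, -p] ^ 2).det = N) (hN : ¬ (8 : ℤ) ∣ N) :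
    ¬ (8 : ℤ) ∣ Algebra.norm ℤ ((x : 𝓞 K) + y * b + z * b ^ 2) := by
  have h := norm_coords_eq_det K h3 b hirr hb x y z
  rw [hdet] at h
  have : Algebra.norm ℤ ((x : 𝓞 K) + y * b + z * b ^ 2) = N := by exact_mod_cast h
  rwa [this]

end NormConjunct

/-! ## §3 THE PER-CURVE DOOR (mod `hLim2` only), cubic currency -/

section CurveDoor

variable {p q r : ℤ}

/-- `[ℚ(θ) : ℚ] = 3` packaged with the `NumberField` instance used below. [folklore] -/
private theorem finrank_adjoin_three (hirr : Irreducible (Cubic.toPoly ⟨1, (p : ℚ), q, r⟩))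
    {θ : AlgebraicClosure ℚ} (hθ : aeval θ (Cubic.toPoly ⟨1, (p : ℚ), q, r⟩) = 0) :
    Module.finrank ℚ (IntermediateField.adjoin ℚ {θ}) = 3 :=
  finrank_adjoin_eq_three_of_irreducible hirr hθ

/-- **`μ₂ = 0` for `ℚ(θ)` from an even-index certificate and two parity bits, UNCONDITIONAL**: `θ` a root of an irreducible integer
cubic, `u, v, m, m' ∈ 𝓞 ℚ(θ)` with `u² − 2v² = 4m`, `m² = 2m'`, `8 ∤ N(2 − m'³)`; then `2 ∤ #Cl(𝓞 ℚ(θ))` and `e_1 = 0` along the cyclotomic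
`ℤ₂`-extension `κ` of `ℚ(θ)` give `μ₂ = 0` (growth form; indeed every `e_n = 0`). [cite: Fukuda1994, Thm. 1 (1), p. 264] -/
theorem classicalMuVanishes_two_adjoin_of_evenIndexCertificate (hirr : Irreducible (Cubic.toPoly ⟨1, (p : ℚ), q, r⟩))
    {θ : AlgebraicClosure ℚ} (hθ : aeval θ (Cubic.toPoly ⟨1, (p : ℚ), q, r⟩) = 0)
    (u v m m' : 𝓞 (IntermediateField.adjoin ℚ {θ})) (huv : u ^ 2 - 2 * v ^ 2 = 4 * m) (hm : m ^ 2 = 2 * m')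
    (hN : ¬ (8 : ℤ) ∣ Algebra.norm ℤ (2 - m' ^ 3))
    (hh : ¬ 2 ∣ Nat.card (ClassGroup (𝓞 (IntermediateField.adjoin ℚ {θ}))))
    (κ : ZpExtension (IntermediateField.adjoin ℚ {θ}) 2) (hκ : κ.IsCyclotomic) (h1 : classNumberPExp κ 1 = 0) :
    ClassicalMuVanishes κ := by
  haveI : FiniteDimensional ℚ (IntermediateField.adjoin ℚ {θ}) :=
    IntermediateField.adjoin.finiteDimensional ((AlgebraicClosure.isAlgebraic ℚ).isAlgebraic θ).isIntegral
  haveI : NumberField (IntermediateField.adjoin ℚ {θ}) := NumberField.mk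
  exact classicalMuVanishes_two_of_evenIndexCertificate_of_layerOne _ (finrank_adjoin_three hirr hθ) u v m m' huv hm hN κ hκ hh h1

/-- **(A)₂ from an even-index certificate and two parity bits, per curve.** Granted `hLim2`: for any elliptic `W/ℚ` and non-zero
`P ∈ W[2]` whose point field is `ℚ(θ)`, `θ` a root of an irreducible integer cubic, an even-index certificate in `𝓞 ℚ(θ)`,
`2 ∤ #Cl(𝓞 ℚ(θ))` and `e_1 = 0` along the cyclotomic `ℤ₂`-extensions of `ℚ(θ)` ⟹ statement (A)₂(W).
[cite: Lim2017FineSelmer, §3 Thm. 3.5 and Lemma 3.2] [cite: Fukuda1994, Thm. 1 (1), p. 264] [cite: CoatesSujatha2005, §3 statement (A)] -/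
theorem fineSelmerDual_moduleFinite_two_of_evenIndexCertificate_pointField
    (hLim2 : Lim2017.thm35_at_two_fineSelmerDual_moduleFinite_of_classicalMuVanishes_of_le_divisionField_four)
    (W : WeierstrassCurve ℚ) [W.IsElliptic] {P : geomTorsion W 2} (hP : P ≠ 0)
    (hirr : Irreducible (Cubic.toPoly ⟨1, (p : ℚ), q, r⟩))
    {θ : AlgebraicClosure ℚ} (hθ : aeval θ (Cubic.toPoly ⟨1, (p : ℚ), q, r⟩) = 0)
    (hFθ : IntermediateField.fixedField (MulAction.stabilizer (absoluteGaloisGroup ℚ) P) = IntermediateField.adjoin ℚ {θ})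
    (u v m m' : 𝓞 (IntermediateField.adjoin ℚ {θ})) (huv : u ^ 2 - 2 * v ^ 2 = 4 * m) (hm : m ^ 2 = 2 * m')
    (hN : ¬ (8 : ℤ) ∣ Algebra.norm ℤ (2 - m' ^ 3))
    (hh : ¬ 2 ∣ Nat.card (ClassGroup (𝓞 (IntermediateField.adjoin ℚ {θ}))))
    (h1 : haveI : FiniteDimensional ℚ (IntermediateField.adjoin ℚ {θ}) :=
        IntermediateField.adjoin.finiteDimensional ((AlgebraicClosure.isAlgebraic ℚ).isAlgebraic θ).isIntegral
      haveI : NumberField (IntermediateField.adjoin ℚ {θ}) := NumberField.mk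
      ∀ κL : ZpExtension (IntermediateField.adjoin ℚ {θ}) 2, κL.IsCyclotomic → classNumberPExp κL 1 = 0)
    (κ : ZpExtension ℚ 2) (hκ : κ.IsCyclotomic) :
    ∃ (γ : absoluteGaloisGroup ℚ) (D : W.FineSelmerDualData κ γ),
      Module.Finite ℤ_[2] (RestrictScalars ℤ_[2] (IwasawaAlgebra 2) D.X) := by
  have hμP : ∀ κL : ZpExtension (IntermediateField.fixedField (MulAction.stabilizer (absoluteGaloisGroup ℚ) P)) 2,
      κL.IsCyclotomic → ClassicalMuVanishes κL := by
    rw [hFθ]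
    exact fun κL hκL ↦ classicalMuVanishes_two_adjoin_of_evenIndexCertificate hirr hθ u v m m' huv hm hN hh κL hκL (h1 κL hκL)
  exact fineSelmerDual_moduleFinite_two_of_classicalMu_pointField hLim2 W hP hμP κ hκ

end CurveDoor

end Summit.BirchSwinnertonDyer.BirchSwinnertonDyer.Theorems.AddKatoTwo

end
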